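import Mathlib
import HarnessLib
import Summits.HubbardSuperconductivity.HubbardSuperconductivity.Theorems.SoloBlindChargePerron

/-!
# The Mathlib spectrum of the hop matrix lies below the charges (Proposition 43, λ_max half —
# `Matrix.IsHermitian.eigenvalues` form; generation 72)

Solo-blind programme `HubbardSuperconductivity`, generation 72, companion of
`SoloBlindChargePerron`: the same inequality stated against Mathlib's own spectral data of the
real symmetric `0/1` hop matrix `A = Matrix.of (fun v w => if R v w then 1 else 0)`.

* `hopMatrix_isHermitian` — for a symmetric relation `R` the hop matrix is Hermitian (real
  symmetric), so Mathlib's `Matrix.IsHermitian.eigenvalues : V → ℝ` and the orthonormal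
  `eigenvectorBasis` are available.
* `eigenvalues_le_charge` — for every AM–GM admissible scheme `u` (`u ≥ 0`, `u v w · u w v ≥ 1`
  on hops) and EVERY index `i`, some `v` has `eigenvalues i ≤ C_u(v) = Σ_{w : R v w} u v w`
  (the eigenvector `eigenvectorBasis i` is nonzero and solves `A x = (eigenvalues i) • x`,
  `Matrix.IsHermitian.mulVec_eigenvectorBasis`; then `ChargePerron.exists_eigenvalue_le_charge_of_mulVec`).
* `iSup_eigenvalues_le_charge` — on a nonempty type, some `v` has `(⨆ i, eigenvalues i) ≤ C_u(v)`:
  literally `λ_max(A) ≤ max_v C_u(v)`, the `λ_max` clause of Proposition 43 (§5.20(19)) for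
  every admissible scheme, with no Perron–Frobenius input.

[this work]
-/

namespace Summit.HubbardSuperconductivity.HubbardSuperconductivity.Theorems.ChargeSpectrum

open Finset Matrix
open Summit.HubbardSuperconductivity.HubbardSuperconductivity.Theorems.ChargePerron

variable {V : Type*} (R : V → V → Prop) [DecidableRel R]

/-- The `0/1` hop matrix of a symmetric relation is Hermitian (real symmetric). [this work] -/
theorem hopMatrix_isHermitian (hR : ∀ v w, R v w → R w v) :
    (Matrix.of fun v w : V => if R v w then (1 : ℝ) else 0).IsHermitian := by
  refine Matrix.IsHermitian.ext fun i j => ?_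
  simp only [Matrix.of_apply, star_trivial]
  by_cases h : R i j
  · rw [if_pos h, if_pos (hR i j h)]
  · have h' : ¬ R j i := fun h'' => h (hR j i h'')
    rw [if_neg h, if_neg h']

variable [Fintype V] [DecidableEq V]

/-- **Every Mathlib eigenvalue of the hop matrix is at most some charge** (Proposition 43,
`λ_max` half, spectral form): for a symmetric relation `R`, an AM–GM admissible scheme `u` and
every index `i`, some `v` has `(hopMatrix_isHermitian R hR).eigenvalues i ≤ Σ_{w : R v w} u v w`.
[this work] -/
theorem eigenvalues_le_charge (hR : ∀ v w, R v w → R w v) (u : V → V → ℝ)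
    (hu : ∀ v w, R v w → 0 ≤ u v w) (huu : ∀ v w, R v w → 1 ≤ u v w * u w v) (i : V) :
    ∃ v, (hopMatrix_isHermitian R hR).eigenvalues i ≤ ∑ w, if R v w then u v w else 0 := by
  set hA := hopMatrix_isHermitian R hR
  have h1 := hA.mulVec_eigenvectorBasis i
  have h2 : (hA.eigenvectorBasis i : EuclideanSpace ℝ V) ≠ 0 :=
    hA.eigenvectorBasis.orthonormal.ne_zero i
  have h3 : (⇑(hA.eigenvectorBasis i) : V → ℝ) ≠ 0 := by
    intro h
    apply h2
    exact (WithLp.equiv 2 (V → ℝ)).injective (by simpa using h)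
  obtain ⟨v, -, hv⟩ :=
    exists_eigenvalue_le_charge_of_mulVec R hR u hu huu h3 (μ := hA.eigenvalues i) (by rw [h1])
  exact ⟨v, hv⟩

/-- **`λ_max(A) ≤ max_v C_u(v)`** (Proposition 43, `λ_max` half, literally): on a nonempty finite
type, for a symmetric relation `R` and every AM–GM admissible scheme `u`, some `v` has
`(⨆ i, eigenvalues i) ≤ Σ_{w : R v w} u v w` — the largest eigenvalue of the hop matrix is a
lower bound for the floor constant of every sign-free AM–GM floor. [this work] -/
theorem iSup_eigenvalues_le_charge [Nonempty V] (hR : ∀ v w, R v w → R w v) (u : V → V → ℝ)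
    (hu : ∀ v w, R v w → 0 ≤ u v w) (huu : ∀ v w, R v w → 1 ≤ u v w * u w v) :
    ∃ v, (⨆ i, (hopMatrix_isHermitian R hR).eigenvalues i) ≤ ∑ w, if R v w then u v w else 0 := by
  obtain ⟨i₀, -, hmax⟩ := Finset.exists_max_image Finset.univ
    (fun i => (hopMatrix_isHermitian R hR).eigenvalues i) Finset.univ_nonempty
  obtain ⟨v, hv⟩ := eigenvalues_le_charge R hR u hu huu i₀
  refine ⟨v, le_trans (ciSup_le fun i => hmax i (Finset.mem_univ i)) hv⟩

end Summit.HubbardSuperconductivity.HubbardSuperconductivity.Theorems.ChargeSpectrum
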